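import Mathlib
import HarnessLib.Audit
import Summits.PneNP.PneNP.Theorems.PstarLiteralPinning

/-!
# Which literals does a slice pin?  (II) Never to zero; the block-join criterion assembled (ROUND-24, O1; memo g27 §70)

FRONTIER range-avoidance ladder, rung F-N3, ROUND 24 (cell `pnp-ideate`, prover-2 memo `g27/O1-PINNING-g27.md` §70; census node
`PstarLocalGateBudgetAssembly.LocalMenuCriterionBoundGateBudget`; restricted-model proof complexity — nothing here bears on `P` versus `NP`).

Companion of `PstarLiteralPinning` (vocabulary `Through`, `InSlice`, `IsJoin`, `joinValue`; `true_of_block_join`;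
`exists_false_of_no_block_join`).  Here:

* **`exists_true_of_slice`** — a literal `s` whose PARTNERS are private (the other AND variable of each output of `K ∪ G₁` through `s` occurs
  in no other AND slot of `K ∪ G₁`, is no XOR variable of `K`, is not read by `C₁`; `s` itself no XOR variable of `K`, `s ∉ C₁`) is NEVER
  pinned to `0`: from any point of the slice, zero the partners and raise `x_s` — nothing else moves (pure instances; no typedness needed);
  `eq_true_of_constant` — so an A-constant literal of this kind is `≡ 1`;
* **`constant_iff_block_join`** — THE CRITERION (typed pure instance, `G₁` disjoint from `K`, `C₁` off the AND variables of `K ∪ G₁`,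
  partners of `s` private, every other output of `K ∪ G₁` with a private AND variable, slice non-empty):
  `x_s` is constant on the slice `Sol(K) ∩ {Γ₁ = b₁}` **iff** some ONE-BLOCK JOIN THROUGH `s` has value `1`.

For the census (p3's (P1)/(P2), STATUS 2026-08-29 13:37Z): the A-constant column of a certificate `(K₀; d₁, ·)` is the list of literals `s`
admitting a join `(D ⊆ K₀, t)` for `C₁ = d₁.1` — an even subgraph, or (t = true) a subgraph whose odd vertices are `C₁` taken together with ALL
folds of `d₁` — consisting of `s`-terms only and of value `Σ_D y + [t] b₁ = 1`.  On a cycle core: the cycle or an arc-with-folds inside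
`{t_i, o_i}` (resp. `{d}`); genuine two-block arcs pin nothing; on a theta core add the third route and the two further cycles.
-/

set_option linter.dupNamespace false -- `Summit.PneNP.PneNP.…`: summit = sub-problem name (D-0017 single-conjunct layout)

open Finset Literature.Computability.Complexity
open Summit.PneNP.PneNP.Theorems.PstarFibrePolys (bit bit_and bit_injective)
open Summit.PneNP.PneNP.Theorems.PstarTyped (Typed)
open Summit.PneNP.PneNP.Theorems.PstarGapPeeling (eval_pure)
open Summit.PneNP.PneNP.Theorems.PstarGapOneAll (gval)
open Summit.PneNP.PneNP.Theorems.PstarGConstraint (bit_gval)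
open Summit.PneNP.PneNP.Theorems.PstarLiteralPinning (Through InSlice IsJoin joinValue true_of_block_join exists_false_of_no_block_join)

namespace Summit.PneNP.PneNP.Theorems.PstarLiteralPinningCriterion

variable {n m : ℕ} {I : LocalMap 4 n m} {y : Fin m → Bool} {K : Finset (Fin m)} {w₁ : Finset (Fin n) × Finset (Fin m) × Bool} {s : Fin n}

/-! ## Literals are never pinned to zero -/

/-- **A literal with private partners is never pinned to `0`.**  `s` is no XOR variable of `K`, `s ∉ C₁`; every partner `w` of `s` (the other
AND variable of an output of `K ∪ G₁` through `s`) is not in `C₁`, is no XOR variable of `K`, and occurs in no other AND slot of `K ∪ G₁`.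
Then from any point of the slice: zero the partners, raise `x_s` — still in the slice. -/
theorem exists_true_of_slice (hI : I.IsPure xorAndPred) (hsX : ∀ j ∈ K, I.vars j 0 ≠ s ∧ I.vars j 1 ≠ s) (hsC : s ∉ w₁.1)
    (hpart : ∀ j ∈ K ∪ w₁.2.1, ∀ w, (I.vars j 2 = s ∧ I.vars j 3 = w) ∨ (I.vars j 2 = w ∧ I.vars j 3 = s) →
      w ∉ w₁.1 ∧ (∀ j' ∈ K, I.vars j' 0 ≠ w ∧ I.vars j' 1 ≠ w) ∧ ∀ j' ∈ K ∪ w₁.2.1, Through I w j' → j' = j)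
    {x : Fin n → Bool} (hx : InSlice I y K w₁ x) : ∃ z, InSlice I y K w₁ z ∧ z s = true := by
  classical
  by_cases hxs : x s = true
  · exact ⟨x, hx, hxs⟩
  rw [Bool.not_eq_true] at hxs
  set F := K ∪ w₁.2.1 with hF
  -- partners of `s`
  let IsPartner : Fin n → Prop := fun w => ∃ j ∈ F, (I.vars j 2 = s ∧ I.vars j 3 = w) ∨ (I.vars j 2 = w ∧ I.vars j 3 = s)
  let z : Fin n → Bool := fun w => if w = s then true else if IsPartner w then false else x w
  have hzs : z s = true := by simp [z]
  have hz_free : ∀ w, w ≠ s → ¬ IsPartner w → z w = x w := fun w h1 h2 => by simp only [z, if_neg h1, if_neg h2]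
  -- every AND term keeps its value
  have hterm : ∀ j ∈ F, (z (I.vars j 2) && z (I.vars j 3)) = (x (I.vars j 2) && x (I.vars j 3)) := by
    intro j hj
    have h23 : I.vars j 2 ≠ I.vars j 3 := fun e => absurd (hI.2 j e) (by decide)
    by_cases h2 : I.vars j 2 = s
    · -- through `s` at slot 2: partner at slot 3 is zeroed; old term vanishes as `x s = 0`
      have hp : IsPartner (I.vars j 3) := ⟨j, hj, Or.inl ⟨h2, rfl⟩⟩
      have hne : I.vars j 3 ≠ s := fun e => h23 (h2.trans e.symm)
      rw [h2, hxs, Bool.false_and]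
      simp only [z, if_neg hne, if_pos hp, Bool.and_false]
    by_cases h3 : I.vars j 3 = s
    · have hp : IsPartner (I.vars j 2) := ⟨j, hj, Or.inr ⟨rfl, h3⟩⟩
      rw [h3, hxs, Bool.and_false]
      simp only [z, if_neg h2, if_pos hp, Bool.false_and]
    -- not through `s`: neither AND variable is a partner (privacy)
    have hnp : ∀ w, Through I w j → ¬ IsPartner w := by
      rintro w hw ⟨j', hj', hj's⟩
      have hj'eq : j = j' := (hpart j' hj' w hj's).2.2 j hj hw
      subst hj'eq
      rcases hj's with ⟨h, _⟩ | ⟨_, h⟩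
      · exact h2 h
      · exact h3 h
    rw [hz_free _ h2 (hnp _ (Or.inl rfl)), hz_free _ h3 (hnp _ (Or.inr rfl))]
  have hxorv : ∀ j ∈ K, ∀ σ : Fin 4, σ = 0 ∨ σ = 1 → z (I.vars j σ) = x (I.vars j σ) := by
    intro j hj σ hσ
    refine hz_free _ ?_ ?_
    · rcases hσ with rfl | rfl; exacts [(hsX j hj).1, (hsX j hj).2]
    · rintro ⟨j', hj', hw⟩
      have := (hpart j' hj' _ hw).2.1 j hj
      rcases hσ with rfl | rfl; exacts [this.1 rfl, this.2 rfl]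
  refine ⟨z, ⟨fun j hj => ?_, ?_⟩, hzs⟩
  · rw [← hx.1 j hj, eval_pure I hI, eval_pure I hI, hxorv j hj 0 (Or.inl rfl), hxorv j hj 1 (Or.inr rfl),
      hterm j (mem_union_left _ hj)]
  · rw [← hx.2]
    apply bit_injective
    rw [bit_gval, bit_gval]
    congr 1
    · refine sum_congr rfl fun w hw => ?_
      rw [hz_free w (fun e => hsC (e ▸ hw)) (fun ⟨j', hj', hw'⟩ => (hpart j' hj' w hw').1 hw)]
    · refine sum_congr rfl fun g hg => ?_
      rw [← bit_and, ← bit_and, hterm g (mem_union_right _ hg)]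

/-! ## The criterion -/

/-- **A-constant literals are pinned to ONE.** -/
theorem eq_true_of_constant (hI : I.IsPure xorAndPred) (hsX : ∀ j ∈ K, I.vars j 0 ≠ s ∧ I.vars j 1 ≠ s) (hsC : s ∉ w₁.1)
    (hpart : ∀ j ∈ K ∪ w₁.2.1, ∀ w, (I.vars j 2 = s ∧ I.vars j 3 = w) ∨ (I.vars j 2 = w ∧ I.vars j 3 = s) →
      w ∉ w₁.1 ∧ (∀ j' ∈ K, I.vars j' 0 ≠ w ∧ I.vars j' 1 ≠ w) ∧ ∀ j' ∈ K ∪ w₁.2.1, Through I w j' → j' = j)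
    (hne : ∃ x, InSlice I y K w₁ x) {e : Bool} (hconst : ∀ z, InSlice I y K w₁ z → z s = e) : e = true := by
  obtain ⟨x, hx⟩ := hne
  obtain ⟨z, hz, hzs⟩ := exists_true_of_slice hI hsX hsC hpart hx
  rw [← hconst z hz, hzs]

/-- **THE BLOCK-JOIN CRITERION.**  On a typed pure instance, for a family `K`, a reader `w₁ = (C₁, G₁, b₁)` with `G₁` disjoint from `K` and `C₁`
off the AND variables of `K ∪ G₁`, and a literal `s` (no XOR variable of `K`, `s ∉ C₁`) with PRIVATE PARTNERS, every other output of `K ∪ G₁`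
having a PRIVATE AND variable, and a non-empty slice: `x_s` is constant on the slice iff some ONE-BLOCK JOIN THROUGH `s` has value `1`
(and then `x_s ≡ 1`). -/
theorem constant_iff_block_join (hI : I.IsPure xorAndPred) (hT : Typed I) (hKG : Disjoint K w₁.2.1)
    (hC₁ : ∀ v ∈ w₁.1, ∀ j ∈ K ∪ w₁.2.1, ¬ Through I v j) (hsX : ∀ j ∈ K, I.vars j 0 ≠ s ∧ I.vars j 1 ≠ s) (hsC : s ∉ w₁.1)
    (hpart : ∀ j ∈ K ∪ w₁.2.1, ∀ w, (I.vars j 2 = s ∧ I.vars j 3 = w) ∨ (I.vars j 2 = w ∧ I.vars j 3 = s) →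
      w ∉ w₁.1 ∧ (∀ j' ∈ K, I.vars j' 0 ≠ w ∧ I.vars j' 1 ≠ w) ∧ ∀ j' ∈ K ∪ w₁.2.1, Through I w j' → j' = j)
    (hfree : ∀ j ∈ K ∪ w₁.2.1, ¬ Through I s j → ∃ p, Through I p j ∧ ∀ j' ∈ K ∪ w₁.2.1, Through I p j' → j' = j)
    (hne : ∃ x, InSlice I y K w₁ x) :
    (∃ e, ∀ z, InSlice I y K w₁ z → z s = e) ↔
      ∃ D ⊆ K, ∃ t : Bool, IsJoin I w₁.1 D t ∧ (∀ j ∈ D, Through I s j) ∧ (t = true → ∀ g ∈ w₁.2.1, Through I s g) ∧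
        joinValue y w₁.2.2 D t = 1 := by
  constructor
  · rintro ⟨e, he⟩
    have het : e = true := eq_true_of_constant hI hsX hsC hpart hne he
    subst het
    by_contra hno
    push Not at hno
    obtain ⟨z, hz, hzs⟩ := exists_false_of_no_block_join hI hT hKG hC₁ hsX hsC hfree hne
      (fun D hD t hJ hDs hGs => hno D hD t hJ hDs hGs)
    have := he z hz
    rw [hzs] at this
    exact Bool.false_ne_true this
  · rintro ⟨D, hD, t, hJ, hDs, hGs, hval⟩
    exact ⟨true, fun z hz => true_of_block_join hI hD hJ hDs hGs hval hz⟩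

end Summit.PneNP.PneNP.Theorems.PstarLiteralPinningCriterion
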